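import Summits.Ventures.DiscreteObjects.PP12.FixedPointCongruences

/-!
# PP(12), family B1-p: an axis forces a centre; a central collineation of prime order q has q ∣ n or q ∣ n − 1
Framing: lottery ticket; floor = certified bounds/negative ranges.

Kernel versions (over Mathlib's `Configuration.ProjectivePlane`) of the two classical facts used in
FAMILY-B1P.md Lemmas 3–5 (cell pub-namedobj, target M):

* `exists_center_of_axis` — a collineation fixing every point of a line `l` (an *axis*) fixes every line
  through some point `c` (a *centre*) [Hughes–Piper, Projective Planes, Thm 4.9];
* `eq_self_of_central_of_fixed` — a central collineation fixing a point off the axis other than the centre is the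
  identity on points (central collineations act semiregularly off `l ∪ {c}`);
* `dvd_order_of_elation` / `dvd_order_sub_one_of_homology` — if moreover `σ ^ q = 1` on points with `q` prime and
  `σ ≠ 1`, then `q ∣ n` when the centre lies on the axis and `q ∣ n − 1` otherwise (`n` = order);
* order 12: a non-trivial collineation with `σ ^ q = 1`, `q ∈ {5, 7, 13}`, has NO axis
  (`not_isAxis_order12`), and for `q = 11` an axis forces the centre OFF the axis — the homology Case A of
  FAMILY-B1P Lemma 4 (`center_not_mem_axis_order12_q11`).

Together with `FixedPointCongruences` (fixed points on a fixed line `≡ 13 (mod q)`) this kernel-checks the case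
splits of Lemmas 3, 4, 5 up to (not including) Bruck's subplane bound and the regular-action normal forms.
-/

namespace Summit.Ventures.DiscreteObjects.PP12

open Configuration Finset

namespace Collineation

variable {P L : Type*} [Membership P L] [ProjectivePlane P L] (σ : Collineation P L)

/-- `l` is an axis of `σ`: every point of `l` is fixed. -/
def IsAxis (l : L) : Prop := ∀ p : P, p ∈ l → σ.onPoints p = p

/-- `c` is a centre of `σ`: every line through `c` is fixed. -/
def IsCenter (c : P) : Prop := ∀ m : L, c ∈ m → σ.onLines m = m

omit [ProjectivePlane P L] in
/-- incidence is transported: `p ∈ m → σ p ∈ σ m` -/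
theorem mem_map {p : P} {m : L} (h : p ∈ m) : σ.onPoints p ∈ σ.onLines m := (σ.mem_iff p m).2 h

/-- A line containing two distinct fixed points is fixed. -/
theorem line_fixed_of_two_fixed {m : L} {p q : P} (hp : p ∈ m) (hq : q ∈ m) (hpq : p ≠ q)
    (fp : σ.onPoints p = p) (fq : σ.onPoints q = q) : σ.onLines m = m := by
  have hp' : p ∈ σ.onLines m := by simpa [fp] using σ.mem_map hp
  have hq' : q ∈ σ.onLines m := by simpa [fq] using σ.mem_map hq
  exact (Nondegenerate.eq_or_eq hp' hq' hp hq).resolve_left hpq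

/-- A point lying on two distinct fixed lines is fixed. -/
theorem point_fixed_of_two_fixed {m₁ m₂ : L} {p : P} (h1 : p ∈ m₁) (h2 : p ∈ m₂) (hne : m₁ ≠ m₂)
    (f1 : σ.onLines m₁ = m₁) (f2 : σ.onLines m₂ = m₂) : σ.onPoints p = p := by
  have h1' : σ.onPoints p ∈ m₁ := by simpa [f1] using σ.mem_map h1
  have h2' : σ.onPoints p ∈ m₂ := by simpa [f2] using σ.mem_map h2
  exact (Nondegenerate.eq_or_eq h1' h1 h2' h2).resolve_right hne

variable [Fintype P] [Fintype L]

omit [Fintype L] in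
/-- Every line carries three distinct points. -/
theorem exists_three_points [Finite L] (m : L) :
    ∃ a b c : P, a ∈ m ∧ b ∈ m ∧ c ∈ m ∧ a ≠ b ∧ a ≠ c ∧ b ≠ c := by
  classical
  have h := ProjectivePlane.two_lt_pointCount P m
  rw [pointCount, Nat.card_eq_fintype_card, Fintype.two_lt_card_iff] at h
  obtain ⟨⟨a, ha⟩, ⟨b, hb⟩, ⟨c, hc⟩, hab, hac, hbc⟩ := h
  exact ⟨a, b, c, ha, hb, hc, fun h => hab (Subtype.ext h), fun h => hac (Subtype.ext h),
    fun h => hbc (Subtype.ext h)⟩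

/-- On any line there is a point different from a given one. -/
theorem exists_mem_ne (m : L) (p : P) : ∃ s : P, s ∈ m ∧ s ≠ p := by
  obtain ⟨a, b, -, ha, hb, -, hab, -, -⟩ := exists_three_points (P := P) m
  by_cases h : a = p
  · exact ⟨b, hb, fun hb' => hab (h.trans hb'.symm)⟩
  · exact ⟨a, ha, h⟩

/-- On any line there is a point not on another, different line. -/
theorem exists_mem_not_mem {m₁ m₂ : L} (hne : m₁ ≠ m₂) : ∃ x : P, x ∈ m₁ ∧ x ∉ m₂ := by
  obtain ⟨a, b, -, ha, hb, -, hab, -, -⟩ := exists_three_points (P := P) m₁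
  by_cases ha2 : a ∈ m₂
  · by_cases hb2 : b ∈ m₂
    · exact absurd ((Nondegenerate.eq_or_eq ha hb ha2 hb2).resolve_left hab) hne
    · exact ⟨b, hb, hb2⟩
  · exact ⟨a, ha, ha2⟩

/-- There is a point lying on neither of two given lines. -/
theorem exists_not_mem_not_mem (m₁ m₂ : L) : ∃ t : P, t ∉ m₁ ∧ t ∉ m₂ := by
  by_cases hne : m₁ = m₂
  · subst hne
    obtain ⟨t, ht⟩ := Nondegenerate.exists_point (P := P) m₁
    exact ⟨t, ht, ht⟩
  obtain ⟨x, hx1, hx2⟩ := exists_mem_not_mem (P := P) hne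
  obtain ⟨y, hy2, hy1⟩ := exists_mem_not_mem (P := P) (Ne.symm hne)
  have hxy : x ≠ y := fun h => hx2 (h ▸ hy2)
  obtain ⟨a, b, c, ha, hb, hc, hab, hac, hbc⟩ := exists_three_points (P := P) (HasLines.mkLine hxy : L)
  have hxm := (HasLines.mkLine_ax (L := L) hxy).1
  have hym := (HasLines.mkLine_ax (L := L) hxy).2
  -- a point t on the line xy different from x and y
  obtain ⟨t, ht, htx, hty⟩ : ∃ t : P, t ∈ (HasLines.mkLine hxy : L) ∧ t ≠ x ∧ t ≠ y := by
    by_cases hax : a = x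
    · subst hax
      by_cases hby : b = y
      · subst hby; exact ⟨c, hc, Ne.symm hac, Ne.symm hbc⟩
      · exact ⟨b, hb, Ne.symm hab, hby⟩
    · by_cases hay : a = y
      · subst hay
        by_cases hbx : b = x
        · subst hbx; exact ⟨c, hc, Ne.symm hbc, Ne.symm hac⟩
        · exact ⟨b, hb, hbx, Ne.symm hab⟩
      · exact ⟨a, ha, hax, hay⟩
  refine ⟨t, fun ht1 => ?_, fun ht2 => ?_⟩
  · -- t, x ∈ m₁ and t, x ∈ xy ⇒ m₁ = xy ⇒ y ∈ m₁
    have := (Nondegenerate.eq_or_eq ht1 hx1 ht hxm).resolve_left htx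
    exact hy1 (this ▸ hym)
  · have := (Nondegenerate.eq_or_eq ht2 hy2 ht hym).resolve_left hty
    exact hx2 (this ▸ hxm)

/-- An axis is itself a fixed line. -/
theorem axis_fixed {l : L} (hl : σ.IsAxis l) : σ.onLines l = l := by
  obtain ⟨a, b, -, ha, hb, -, hab, -, -⟩ := exists_three_points (P := P) l
  exact σ.line_fixed_of_two_fixed ha hb hab (hl a ha) (hl b hb)

/-- A point off the axis is moved off the axis. -/
theorem map_not_mem_axis {l : L} (hl : σ.IsAxis l) {r : P} (hr : r ∉ l) : σ.onPoints r ∉ l := by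
  intro h
  have : σ.onPoints r ∈ σ.onLines l := by rwa [σ.axis_fixed hl]
  exact hr ((σ.mem_iff r l).1 this)

/-- In the presence of an axis `l`, the line joining a moved point `r ∉ l` to its image is fixed. -/
theorem line_through_image_fixed {l : L} (hl : σ.IsAxis l) {r : P} (hr : r ∉ l)
    (hmov : σ.onPoints r ≠ r) :
    σ.onLines (HasLines.mkLine hmov.symm : L) = HasLines.mkLine hmov.symm := by
  set m : L := HasLines.mkLine hmov.symm with hm
  have hrm : r ∈ m := (HasLines.mkLine_ax hmov.symm).1
  have hσrm : σ.onPoints r ∈ m := (HasLines.mkLine_ax hmov.symm).2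
  have hml : m ≠ l := fun h => hr (h ▸ hrm)
  -- x = m ∩ l is fixed; σ m contains σ r and x; so does m
  set x : P := HasPoints.mkPoint hml with hx
  have hxm : x ∈ m := (HasPoints.mkPoint_ax hml).1
  have hxl : x ∈ l := (HasPoints.mkPoint_ax hml).2
  have fx : σ.onPoints x = x := hl x hxl
  have h1 : σ.onPoints r ∈ σ.onLines m := σ.mem_map hrm
  have h2 : x ∈ σ.onLines m := by simpa [fx] using σ.mem_map hxm
  have hne : σ.onPoints r ≠ x := fun h => σ.map_not_mem_axis hl hr (h ▸ hxl)
  exact (Nondegenerate.eq_or_eq h1 h2 hσrm hxm).resolve_left hne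

/-- **Axis ⇒ centre** [Hughes–Piper Thm 4.9]. A collineation of a finite projective plane fixing every point of
a line fixes every line through some point. -/
theorem exists_center_of_axis {l : L} (hl : σ.IsAxis l) : ∃ c : P, σ.IsCenter c := by
  by_cases hcase : ∃ c : P, c ∉ l ∧ σ.onPoints c = c
  · -- Case 1: a fixed point off the axis is a centre
    obtain ⟨c, hcl, fc⟩ := hcase
    refine ⟨c, fun m hcm => ?_⟩
    have hml : m ≠ l := fun h => hcl (h ▸ hcm)
    have hxm := (HasPoints.mkPoint_ax (P := P) hml).1
    have hxl := (HasPoints.mkPoint_ax (P := P) hml).2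
    have hcx : c ≠ HasPoints.mkPoint hml := fun h => hcl (h ▸ hxl)
    exact σ.line_fixed_of_two_fixed hcm hxm hcx fc (hl _ hxl)
  · -- Case 2: every point off the axis is moved; the centre lies on the axis
    push Not at hcase
    obtain ⟨r, hr⟩ := Nondegenerate.exists_point (P := P) l
    have hmov : σ.onPoints r ≠ r := hcase r hr
    set m : L := HasLines.mkLine hmov.symm with hm
    have hrm : r ∈ m := (HasLines.mkLine_ax hmov.symm).1
    have hml : m ≠ l := fun h => hr (h ▸ hrm)
    have fm : σ.onLines m = m := σ.line_through_image_fixed hl hr hmov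
    set c : P := HasPoints.mkPoint hml with hc
    have hcm : c ∈ m := (HasPoints.mkPoint_ax hml).1
    have hcl : c ∈ l := (HasPoints.mkPoint_ax hml).2
    refine ⟨c, fun m' hcm' => ?_⟩
    by_cases h1 : m' = l
    · subst h1; exact σ.axis_fixed hl
    by_cases h2 : m' = m
    · subst h2; exact fm
    -- a point s ∈ m' off l and off m; its own fixed line m_s passes through c, hence equals m'
    obtain ⟨s, hsm', hsc⟩ := exists_mem_ne (P := P) m' c
    have hsl : s ∉ l := fun h => h1 ((Nondegenerate.eq_or_eq hsm' hcm' h hcl).resolve_left hsc)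
    have hsm : s ∉ m := fun h => h2 ((Nondegenerate.eq_or_eq hsm' hcm' h hcm).resolve_left hsc)
    have hsmov : σ.onPoints s ≠ s := hcase s hsl
    set ms : L := HasLines.mkLine hsmov.symm with hms
    have hsms : s ∈ ms := (HasLines.mkLine_ax hsmov.symm).1
    have fms : σ.onLines ms = ms := σ.line_through_image_fixed hl hsl hsmov
    have hmsm : ms ≠ m := fun h => hsm (h ▸ hsms)
    -- z = ms ∩ m is fixed, hence on l, hence = c
    set z : P := HasPoints.mkPoint hmsm with hz
    have hzms : z ∈ ms := (HasPoints.mkPoint_ax hmsm).1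
    have hzm : z ∈ m := (HasPoints.mkPoint_ax hmsm).2
    have fz : σ.onPoints z = z := σ.point_fixed_of_two_fixed hzms hzm hmsm fms fm
    have hzl : z ∈ l := by
      by_contra hzl; exact hcase z hzl fz
    have hzc : z = c := (Nondegenerate.eq_or_eq hzm hcm hzl hcl).resolve_right hml
    have hcms : c ∈ ms := hzc ▸ hzms
    have : ms = m' := (Nondegenerate.eq_or_eq hsms hcms hsm' hcm').resolve_left hsc
    rw [← this]; exact fms

/-- A centre is a fixed point (given an axis). -/
theorem center_fixed {l : L} {c : P} (hl : σ.IsAxis l) (hc : σ.IsCenter c) : σ.onPoints c = c := by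
  by_cases hcl : c ∈ l
  · exact hl c hcl
  obtain ⟨a, b, -, ha, hb, -, hab, -, -⟩ := exists_three_points (P := P) l
  have hca : c ≠ a := fun h => hcl (h ▸ ha)
  have hcb : c ≠ b := fun h => hcl (h ▸ hb)
  have h1 := HasLines.mkLine_ax (L := L) hca
  have h2 := HasLines.mkLine_ax (L := L) hcb
  have hne : (HasLines.mkLine hca : L) ≠ HasLines.mkLine hcb := by
    intro h
    have hb1 : b ∈ (HasLines.mkLine hca : L) := h ▸ h2.2
    have : (HasLines.mkLine hca : L) = l := (Nondegenerate.eq_or_eq h1.2 hb1 ha hb).resolve_left hab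
    exact hcl (this ▸ h1.1)
  exact σ.point_fixed_of_two_fixed h1.1 h2.1 hne (hc _ h1.1) (hc _ h2.1)

omit [Fintype P] [Fintype L] in
/-- Step A of semiregularity: with axis `l`, centre `c` and a further fixed point `r ∉ l`, `r ≠ c`, every point
off the line `rc` is fixed. -/
theorem fixed_of_not_mem_line {l : L} {c r : P} (hl : σ.IsAxis l) (hc : σ.IsCenter c) (hr : r ∉ l)
    (hrc : r ≠ c) (fr : σ.onPoints r = r) {s : P}
    (hs : s ∉ (HasLines.mkLine hrc : L)) : σ.onPoints s = s := by
  have hrm0 := (HasLines.mkLine_ax (L := L) hrc).1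
  have hcm0 := (HasLines.mkLine_ax (L := L) hrc).2
  have hsr : r ≠ s := fun h => hs (h ▸ hrm0)
  have hsc : c ≠ s := fun h => hs (h ▸ hcm0)
  -- line rs is fixed (two fixed points r and rs ∩ l)
  set rs : L := HasLines.mkLine hsr with hrs
  have hrrs : r ∈ rs := (HasLines.mkLine_ax hsr).1
  have hsrs : s ∈ rs := (HasLines.mkLine_ax hsr).2
  have hrsl : rs ≠ l := fun h => hr (h ▸ hrrs)
  have hx := HasPoints.mkPoint_ax (P := P) hrsl
  have hrx : r ≠ HasPoints.mkPoint (P := P) hrsl := fun h => hr (h ▸ hx.2)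
  have frs : σ.onLines rs = rs := σ.line_fixed_of_two_fixed hrrs hx.1 hrx fr (hl _ hx.2)
  -- line cs is fixed (centre)
  set cs : L := HasLines.mkLine hsc with hcs
  have hccs : c ∈ cs := (HasLines.mkLine_ax hsc).1
  have hscs : s ∈ cs := (HasLines.mkLine_ax hsc).2
  have fcs : σ.onLines cs = cs := hc cs hccs
  have hne : rs ≠ cs := by
    intro h
    have hcrs : c ∈ rs := h ▸ hccs
    have : rs = HasLines.mkLine hrc := (Nondegenerate.eq_or_eq hrrs hcrs hrm0 hcm0).resolve_left hrc
    exact hs (this ▸ hsrs)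
  exact σ.point_fixed_of_two_fixed hsrs hscs hne frs fcs

/-- **Semiregularity.** A collineation with axis `l` and centre `c` which fixes a point off `l` other than `c`
fixes every point. -/
theorem eq_self_of_central_of_fixed {l : L} {c r : P} (hl : σ.IsAxis l) (hc : σ.IsCenter c) (hr : r ∉ l)
    (hrc : r ≠ c) (fr : σ.onPoints r = r) (s : P) : σ.onPoints s = s := by
  by_cases hsl : s ∈ l
  · exact hl s hsl
  by_cases hs : s ∈ (HasLines.mkLine hrc : L)
  swap
  · exact σ.fixed_of_not_mem_line hl hc hr hrc fr hs
  by_cases hsc : s = c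
  · subst hsc; exact σ.center_fixed hl hc
  -- s on the line rc: use an auxiliary fixed point t off rc and off l
  obtain ⟨t, ht0, htl⟩ := exists_not_mem_not_mem (P := P) (HasLines.mkLine hrc : L) l
  have ft : σ.onPoints t = t := σ.fixed_of_not_mem_line hl hc hr hrc fr ht0
  have htc : t ≠ c := fun h => ht0 (by rw [h]; exact (HasLines.mkLine_ax (L := L) hrc).2)
  refine σ.fixed_of_not_mem_line hl hc htl htc ft fun hs1 => ?_
  -- s, c on both lines tc and rc ⇒ equal ⇒ t ∈ rc
  have h1 := HasLines.mkLine_ax (L := L) htc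
  have : (HasLines.mkLine htc : L) = HasLines.mkLine hrc :=
    (Nondegenerate.eq_or_eq hs1 h1.2 hs (HasLines.mkLine_ax hrc).2).resolve_left hsc
  exact ht0 (this ▸ h1.1)

variable [DecidableEq P]

/-- The fixed points of a non-trivial central collineation on a line `m ≠ l` through the centre `c ∈ l`
(elation case) are `c` alone. -/
theorem fixedOnLine_eq_one_of_elation {l m : L} {c : P} [DecidablePred (· ∈ m)] (hl : σ.IsAxis l)
    (hc : σ.IsCenter c) (hcl : c ∈ l) (hcm : c ∈ m) (hml : m ≠ l) (hne : σ.onPoints ≠ 1) :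
    σ.fixedOnLine m = 1 := by
  unfold fixedOnLine
  rw [Finset.card_eq_one]
  refine ⟨c, ?_⟩
  ext p
  simp only [mem_filter, mem_univ, true_and, mem_singleton]
  constructor
  · rintro ⟨hpm, fp⟩
    by_contra hpc
    have hpl : p ∉ l := fun hpl => hpc ((Nondegenerate.eq_or_eq hpm hcm hpl hcl).resolve_right hml)
    apply hne
    ext s
    simpa using σ.eq_self_of_central_of_fixed hl hc hpl hpc fp s
  · rintro rfl; exact ⟨hcm, σ.center_fixed hl hc⟩

/-- The fixed points of a non-trivial central collineation on a line `m ≠ l` through the centre `c ∉ l`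
(homology case) are `c` and `m ∩ l`. -/
theorem fixedOnLine_eq_two_of_homology {l m : L} {c : P} [DecidablePred (· ∈ m)] (hl : σ.IsAxis l)
    (hc : σ.IsCenter c) (hcl : c ∉ l) (hcm : c ∈ m) (hne : σ.onPoints ≠ 1) :
    σ.fixedOnLine m = 2 := by
  have hml : m ≠ l := fun h => hcl (h ▸ hcm)
  have hx := HasPoints.mkPoint_ax (P := P) hml
  set x := HasPoints.mkPoint (P := P) hml
  have hcx : c ≠ x := fun h => hcl (h ▸ hx.2)
  unfold fixedOnLine
  rw [Finset.card_eq_two]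
  refine ⟨c, x, hcx, ?_⟩
  ext p
  simp only [mem_filter, mem_univ, true_and, mem_insert, mem_singleton]
  constructor
  · rintro ⟨hpm, fp⟩
    by_contra hp
    push Not at hp
    have hpl : p ∉ l := fun hpl => hp.2 ((Nondegenerate.eq_or_eq hpm hx.1 hpl hx.2).resolve_right hml)
    apply hne
    ext s
    simpa using σ.eq_self_of_central_of_fixed hl hc hpl hp.1 fp s
  · rintro (rfl | rfl)
    · exact ⟨hcm, σ.center_fixed hl hc⟩
    · exact ⟨hx.1, hl _ hx.2⟩

omit [ProjectivePlane P L] [Fintype P] [Fintype L] [DecidableEq P] in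
/-- A non-trivial collineation moves some point. -/
theorem exists_moved (hne : σ.onPoints ≠ 1) : ∃ s : P, σ.onPoints s ≠ s := by
  by_contra h; push Not at h; exact hne (Equiv.ext h)

/-- **Elation order.** If `σ ≠ 1` has axis `l` and centre `c ∈ l`, and `σ ^ q = 1` on points with `q` prime,
then `q` divides the order `n` of the plane. -/
theorem dvd_order_of_elation {l : L} {c : P} (hl : σ.IsAxis l) (hc : σ.IsCenter c) (hcl : c ∈ l)
    (hne : σ.onPoints ≠ 1) {q : ℕ} [Fact q.Prime] (hq : σ.onPoints ^ q = 1) :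
    q ∣ ProjectivePlane.order P L := by
  classical
  obtain ⟨s, hs⟩ := σ.exists_moved hne
  have hcs : c ≠ s := fun h => hs (h ▸ σ.center_fixed hl hc)
  set m : L := HasLines.mkLine hcs
  have hcm : c ∈ m := (HasLines.mkLine_ax hcs).1
  have hsm : s ∈ m := (HasLines.mkLine_ax hcs).2
  have hml : m ≠ l := fun h => hs (hl s (h ▸ hsm))
  have h1 := σ.fixedOnLine_modEq (hc m hcm) hq
  rw [σ.fixedOnLine_eq_one_of_elation hl hc hcl hcm hml hne] at h1
  have := (Nat.modEq_iff_dvd' (by omega)).mp h1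
  simpa using this

/-- **Homology order.** If `σ ≠ 1` has axis `l` and centre `c ∉ l`, and `σ ^ q = 1` on points with `q`
prime, then `q` divides `n − 1`. -/
theorem dvd_order_sub_one_of_homology {l : L} {c : P} (hl : σ.IsAxis l) (hc : σ.IsCenter c)
    (hcl : c ∉ l) (hne : σ.onPoints ≠ 1) {q : ℕ} [Fact q.Prime] (hq : σ.onPoints ^ q = 1) :
    q ∣ ProjectivePlane.order P L - 1 := by
  classical
  obtain ⟨s, hs⟩ := σ.exists_moved hne
  have hcs : c ≠ s := fun h => hs (h ▸ σ.center_fixed hl hc)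
  set m : L := HasLines.mkLine hcs
  have hcm : c ∈ m := (HasLines.mkLine_ax hcs).1
  have h1 := σ.fixedOnLine_modEq (hc m hcm) hq
  rw [σ.fixedOnLine_eq_two_of_homology hl hc hcl hcm hne] at h1
  have := (Nat.modEq_iff_dvd' (by have := ProjectivePlane.one_lt_order P L; omega)).mp h1
  have e : ProjectivePlane.order P L + 1 - 2 = ProjectivePlane.order P L - 1 := by omega
  rwa [e] at this

/-- **Order 12, q ∈ {5, 7, 13}: no axis.** A non-trivial collineation of a projective plane of order 12 with
`σ ^ q = 1` on points, `q ∈ {5, 7, 13}`, fixes no line pointwise (neither `q ∣ 12` nor `q ∣ 11`). -/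
theorem not_isAxis_order12 (h12 : ProjectivePlane.order P L = 12) (hne : σ.onPoints ≠ 1) {q : ℕ}
    [Fact q.Prime] (hq : σ.onPoints ^ q = 1) (hq' : q = 5 ∨ q = 7 ∨ q = 13) (l : L) : ¬ σ.IsAxis l := by
  intro hl
  obtain ⟨c, hc⟩ := σ.exists_center_of_axis hl
  by_cases hcl : c ∈ l
  · have h := σ.dvd_order_of_elation hl hc hcl hne hq
    rw [h12] at h
    rcases hq' with rfl | rfl | rfl <;> revert h <;> decide
  · have h := σ.dvd_order_sub_one_of_homology hl hc hcl hne hq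
    rw [h12] at h
    rcases hq' with rfl | rfl | rfl <;> revert h <;> decide

/-- **Order 12, q = 11: an axis forces a homology.** If a non-trivial collineation with `σ¹¹ = 1` fixes a line
pointwise, every centre lies OFF that line (`11 ∤ 12`): Case A of FAMILY-B1P Lemma 4 is the homology case. -/
theorem center_not_mem_axis_order12_q11 (h12 : ProjectivePlane.order P L = 12) (hne : σ.onPoints ≠ 1)
    (hq : σ.onPoints ^ 11 = 1) {l : L} (hl : σ.IsAxis l) {c : P} (hc : σ.IsCenter c) : c ∉ l := by
  haveI : Fact (Nat.Prime 11) := ⟨by norm_num⟩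
  intro hcl
  have h := σ.dvd_order_of_elation hl hc hcl hne hq
  rw [h12] at h
  revert h; decide

end Collineation

end Summit.Ventures.DiscreteObjects.PP12
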